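import Mathlib
import HarnessLib

/-!
# QUANT lane R8 — binomial toolkit for the discounted block-star row (pmf/cdf recursions, thinning, Markov, chord below a
# concave sequence, constant-gate product weights on `Fin m`)

builds on p205010 (kernel theorem, internal audit signed; external expert review pending)

Support file (`--supports stmt-CriticalPhenomena-4575`), seat `prim-quant-census-1` (gen 7).  Elementary facts about the binomial
distribution written as explicit finite sums (two `local notation`s, no definitions), used by
`…QuantDiscountedBlockStarRow.lean` (the binomial core of FAR on the one-block loose-hub tree; memo
`run/shared/lean/prim/quant/prim-quant-census-1/FAR-LOOSE-HUB-ONE-BLOCK.md`).  Contents: Pascal's rule for pmf and cdf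
(`bpmf_succ_succ`, `bcdf_succ`), monotonicity of the pmf in the number of trials below the mode (`bpmf_le_succ`), the mean and the Markov
tail bound (`bin_mean`, `bin_markov`), the THINNING identities `Bin(Bin(m,λ), q) = Bin(m, λq)` (`bpmf_thin`, `bcdf_thin`), the chord
inequality for discretely concave sequences (`chord_of_concave`), and the passage from constant-gate product weights on subsets of `Fin m`
to binomial sums (`prod_ite_const`, `sum_weight_card_le`).  No sorries; standard axioms.  [folklore]
-/

open Finset

namespace Summit.CriticalPhenomena.PercolationContinuityZ3.Theorems

namespace QuantCensus.DiscountRow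

/-- binomial pmf `P(Bin(K,q) = n)` -/
local notation3 "bpmf[" K ", " n ", " q "]" => (((Nat.choose K n : ℕ) : ℝ) * q ^ n * (1 - q) ^ (K - n))
/-- binomial cdf `P(Bin(K,q) ≤ n)` -/
local notation3 "bcdf[" K ", " n ", " q "]" => (∑ i ∈ Finset.range (n + 1), ((Nat.choose K i : ℕ) : ℝ) * q ^ i * (1 - q) ^ (K - i))

/-- The binomial pmf is nonnegative for `q ∈ [0,1]`. [folklore] -/
theorem bpmf_nonneg (K n : ℕ) {q : ℝ} (hq0 : 0 ≤ q) (hq1 : q ≤ 1) : 0 ≤ bpmf[K, n, q] := by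
  have : 0 ≤ 1 - q := by linarith
  positivity

/-- With no trials every cdf value is `1`. [folklore] -/
theorem bcdf_zero_left (n : ℕ) (q : ℝ) : bcdf[0, n, q] = 1 := by
  rw [Finset.sum_eq_single 0]
  · simp
  · intro i _ hi
    simp [Nat.choose_eq_zero_of_lt (Nat.pos_of_ne_zero hi)]
  · intro h; simp at h

/-- total mass `∑_{i ≤ K} pmf = 1` -/
theorem bcdf_self (K : ℕ) (q : ℝ) : bcdf[K, K, q] = 1 := by
  have h1 : (q + (1 - q)) ^ K = 1 := by rw [show q + (1 - q) = 1 by ring]; exact one_pow K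
  calc bcdf[K, K, q] = ∑ m ∈ Finset.range (K + 1), q ^ m * (1 - q) ^ (K - m) * ((Nat.choose K m : ℕ) : ℝ) :=
        Finset.sum_congr rfl (fun i _ => by ring)
    _ = (q + (1 - q)) ^ K := (add_pow q (1 - q) K).symm
    _ = 1 := h1

/-- terms beyond `K` vanish, so `bcdf[K, n, q] = 1` for `n ≥ K` -/
theorem bcdf_of_le (K n : ℕ) (q : ℝ) (h : K ≤ n) : bcdf[K, n, q] = 1 := by
  have hsub : bcdf[K, K, q] = bcdf[K, n, q] := by
    apply Finset.sum_subset (Finset.range_mono (Nat.succ_le_succ h))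
    intro i hi hi'
    simp only [Finset.mem_range, not_lt] at hi hi'
    simp [Nat.choose_eq_zero_of_lt (by omega : K < i)]
  rw [← hsub, bcdf_self]

/-- Pascal for the pmf: `P(Bin(K+1,q) = i+1) = (1−q)·P(Bin(K,q) = i+1) + q·P(Bin(K,q) = i)` -/
theorem bpmf_succ_succ (K i : ℕ) (q : ℝ) :
    bpmf[K + 1, i + 1, q] = (1 - q) * bpmf[K, i + 1, q] + q * bpmf[K, i, q] := by
  have hc : ((Nat.choose (K + 1) (i + 1) : ℕ) : ℝ) = (Nat.choose K i : ℕ) + (Nat.choose K (i + 1) : ℕ) := by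
    rw [Nat.choose_succ_succ]; push_cast; ring
  rw [hc]
  rcases Nat.lt_or_ge K (i + 1) with hlt | hge
  · have h0 : ((Nat.choose K (i + 1) : ℕ) : ℝ) = 0 := by simp [Nat.choose_eq_zero_of_lt hlt]
    rw [h0]
    rcases Nat.lt_or_ge K i with hlt' | hge'
    · have h0' : ((Nat.choose K i : ℕ) : ℝ) = 0 := by simp [Nat.choose_eq_zero_of_lt hlt']
      rw [h0']; ring
    · have hK : K = i := by omega
      subst hK
      simp only [Nat.sub_self, pow_zero, mul_one, add_zero]
      ring
  · have e1 : K + 1 - (i + 1) = K - i := by omega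
    have e2 : K - i = (K - (i + 1)) + 1 := by omega
    rw [e1, e2, pow_succ, pow_succ]
    ring

/-- `P(Bin(K+1,q) = 0) = (1−q)·P(Bin(K,q) = 0)` -/
theorem bpmf_succ_zero (K : ℕ) (q : ℝ) : bpmf[K + 1, 0, q] = (1 - q) * bpmf[K, 0, q] := by
  simp [pow_succ]; ring

/-- adding one trial: `P(Bin(K+1,q) ≤ n) = P(Bin(K,q) ≤ n) − q·P(Bin(K,q) = n)` -/
theorem bcdf_succ (K n : ℕ) (q : ℝ) : bcdf[K + 1, n, q] = bcdf[K, n, q] - q * bpmf[K, n, q] := by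
  induction n with
  | zero =>
    rw [zero_add, Finset.sum_range_one, Finset.sum_range_one, bpmf_succ_zero]
    ring
  | succ n ih =>
    have hl : bcdf[K + 1, n + 1, q] = bcdf[K + 1, n, q] + bpmf[K + 1, n + 1, q] := Finset.sum_range_succ _ _
    have hr : bcdf[K, n + 1, q] = bcdf[K, n, q] + bpmf[K, n + 1, q] := Finset.sum_range_succ _ _
    rw [hl, hr, ih, bpmf_succ_succ]
    ring

/-- the pmf is non-decreasing in the number of trials while `(K+1) q ≤ n`: `P(Bin(K,q) = n) ≤ P(Bin(K+1,q) = n)` -/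
theorem bpmf_le_succ (K n : ℕ) {q : ℝ} (hq0 : 0 ≤ q) (hq1 : q ≤ 1) (h : ((K : ℝ) + 1) * q ≤ n) :
    bpmf[K, n, q] ≤ bpmf[K + 1, n, q] := by
  rcases Nat.lt_or_ge K n with hlt | hge
  · have h0 : ((Nat.choose K n : ℕ) : ℝ) = 0 := by simp [Nat.choose_eq_zero_of_lt hlt]
    rw [h0, zero_mul, zero_mul]
    exact bpmf_nonneg (K + 1) n hq0 hq1
  · -- K ≥ n: use choose_mul_succ_eq: K.choose n * (K+1) = (K+1).choose n * (K+1-n)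
    have hid : ((Nat.choose K n : ℕ) : ℝ) * ((K : ℝ) + 1) = ((Nat.choose (K + 1) n : ℕ) : ℝ) * ((K : ℝ) + 1 - n) := by
      have := Nat.choose_mul_succ_eq K n
      have hcast : ((K.choose n * (K + 1) : ℕ) : ℝ) = (((K + 1).choose n * (K + 1 - n) : ℕ) : ℝ) := by rw [this]
      push_cast at hcast
      rw [Nat.cast_sub (by omega : n ≤ K + 1)] at hcast
      push_cast at hcast
      linarith
    have e : K + 1 - n = (K - n) + 1 := by omega
    rw [e, pow_succ]
    -- goal: C(K,n) q^n (1-q)^(K-n) ≤ C(K+1,n) q^n ((1-q)^(K-n) * (1-q))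
    have hq' : 0 ≤ 1 - q := by linarith
    have hpos : 0 ≤ q ^ n * (1 - q) ^ (K - n) := by positivity
    have hK1 : (0 : ℝ) < (K : ℝ) + 1 := by positivity
    -- C(K,n) ≤ C(K+1,n) (1-q)  ⟸  C(K,n)(K+1) ≤ C(K+1,n)(K+1)(1-q) = C(K+1,n)((K+1) - (K+1)q) and (K+1)q ≤ n
    have key : ((Nat.choose K n : ℕ) : ℝ) ≤ ((Nat.choose (K + 1) n : ℕ) : ℝ) * (1 - q) := by
      have h2 : ((Nat.choose (K + 1) n : ℕ) : ℝ) * ((K : ℝ) + 1 - n) ≤ ((Nat.choose (K + 1) n : ℕ) : ℝ) * (((K : ℝ) + 1) * (1 - q)) := by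
        apply mul_le_mul_of_nonneg_left _ (by positivity)
        linarith
      have h3 : ((Nat.choose K n : ℕ) : ℝ) * ((K : ℝ) + 1) ≤ (((Nat.choose (K + 1) n : ℕ) : ℝ) * (1 - q)) * ((K : ℝ) + 1) := by
        rw [hid]; linarith
      exact le_of_mul_le_mul_right h3 hK1
    calc ((Nat.choose K n : ℕ) : ℝ) * q ^ n * (1 - q) ^ (K - n)
        = ((Nat.choose K n : ℕ) : ℝ) * (q ^ n * (1 - q) ^ (K - n)) := by ring
      _ ≤ (((Nat.choose (K + 1) n : ℕ) : ℝ) * (1 - q)) * (q ^ n * (1 - q) ^ (K - n)) :=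
          mul_le_mul_of_nonneg_right key hpos
      _ = ((Nat.choose (K + 1) n : ℕ) : ℝ) * q ^ n * ((1 - q) ^ (K - n) * (1 - q)) := by ring

/-- binomial mean: `∑_i i · P(Bin(K,q) = i) = K q` -/
theorem bin_mean (K : ℕ) (q : ℝ) : ∑ i ∈ Finset.range (K + 1), (i : ℝ) * bpmf[K, i, q] = K * q := by
  induction K with
  | zero => simp
  | succ K ih =>
    rw [Finset.sum_range_succ', Nat.cast_zero, zero_mul, add_zero]
    have : ∀ i ∈ Finset.range (K + 1), ((i + 1 : ℕ) : ℝ) * bpmf[K + 1, i + 1, q] =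
        (1 - q) * ((i : ℝ) * bpmf[K, i + 1, q]) + (1 - q) * bpmf[K, i + 1, q] + q * ((i : ℝ) * bpmf[K, i, q]) + q * bpmf[K, i, q] := by
      intro i _
      rw [bpmf_succ_succ]; push_cast; ring
    rw [Finset.sum_congr rfl this, Finset.sum_add_distrib, Finset.sum_add_distrib, Finset.sum_add_distrib,
      ← Finset.mul_sum, ← Finset.mul_sum, ← Finset.mul_sum, ← Finset.mul_sum]
    -- pieces: ∑_{i<K+1} i·pmf(K,i+1): shift; ∑ pmf(K,i+1) = 1 - pmf(K,0); ∑ i pmf(K,i) = Kq; ∑ pmf(K,i) = 1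
    have hA : ∑ i ∈ Finset.range (K + 1), (i : ℝ) * bpmf[K, i + 1, q] = K * q - (1 - bpmf[K, 0, q]) := by
      have h1 : ∑ i ∈ Finset.range (K + 1), ((i : ℝ) + 1) * bpmf[K, i + 1, q] = K * q := by
        have := ih
        rw [Finset.sum_range_succ'] at this
        simp only [Nat.cast_zero, zero_mul, add_zero] at this
        rw [← this]
        have hlast : ((K + 1 : ℕ) : ℝ) * bpmf[K, K + 1, q] = 0 := by
          simp [Nat.choose_succ_self]
        rw [Finset.sum_range_succ]
        push_cast
        rw [show (((K : ℝ) + 1) * bpmf[K, K + 1, q]) = 0 by exact_mod_cast hlast, add_zero]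
      have h2 : ∑ i ∈ Finset.range (K + 1), bpmf[K, i + 1, q] = 1 - bpmf[K, 0, q] := by
        have h3 : bcdf[K, K + 1, q] = 1 := bcdf_of_le K (K + 1) q (by omega)
        rw [Finset.sum_range_succ'] at h3
        simp only [Nat.choose_zero_right, Nat.cast_one, one_mul, pow_zero, Nat.sub_zero] at h3 ⊢
        linarith
      have : ∑ i ∈ Finset.range (K + 1), (i : ℝ) * bpmf[K, i + 1, q] =
          ∑ i ∈ Finset.range (K + 1), ((i : ℝ) + 1) * bpmf[K, i + 1, q] - ∑ i ∈ Finset.range (K + 1), bpmf[K, i + 1, q] := by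
        rw [← Finset.sum_sub_distrib]; exact Finset.sum_congr rfl (fun i _ => by ring)
      rw [this, h1, h2]
    have hB : ∑ i ∈ Finset.range (K + 1), bpmf[K, i + 1, q] = 1 - bpmf[K, 0, q] := by
      have h3 : bcdf[K, K + 1, q] = 1 := bcdf_of_le K (K + 1) q (by omega)
      rw [Finset.sum_range_succ'] at h3
      simp only [Nat.choose_zero_right, Nat.cast_one, one_mul, pow_zero, Nat.sub_zero] at h3 ⊢
      linarith
    have hC : ∑ i ∈ Finset.range (K + 1), bpmf[K, i, q] = 1 := bcdf_self K q
    rw [hA, hB, ih, hC]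
    have h0 : bpmf[K, 0, q] = (1 - q) ^ K := by simp
    rw [h0]; push_cast; ring

/-- Markov for the binomial upper tail: `t · P(Bin(K,q) ≥ t) ≤ K q`, i.e. `t (1 − P(Bin ≤ t−1)) ≤ K q` for `t ≥ 1`. -/
theorem bin_markov (K t : ℕ) {q : ℝ} (hq0 : 0 ≤ q) (hq1 : q ≤ 1) (ht : 1 ≤ t) :
    (t : ℝ) * (1 - bcdf[K, t - 1, q]) ≤ K * q := by
  rw [← bin_mean K q]
  -- 1 - bcdf[K, t-1] = ∑_{i ∈ range (K+1) \ range t} pmf   (when t ≤ K+1; else bcdf = 1 and LHS ≤ 0)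
  rcases Nat.lt_or_ge K t with hlt | hge
  · have : bcdf[K, t - 1, q] = 1 := bcdf_of_le K (t - 1) q (by omega)
    rw [this, sub_self, mul_zero]
    exact Finset.sum_nonneg fun i _ => mul_nonneg (Nat.cast_nonneg i) (bpmf_nonneg K i hq0 hq1)
  · have hsplit : bcdf[K, K, q] = bcdf[K, t - 1, q] + ∑ i ∈ Finset.Ico t (K + 1), bpmf[K, i, q] := by
      rw [Finset.range_eq_Ico, Finset.range_eq_Ico]
      have : t - 1 + 1 = t := by omega
      rw [this]
      exact (Finset.sum_Ico_consecutive _ (by omega) (by omega)).symm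
    rw [bcdf_self] at hsplit
    have htail : 1 - bcdf[K, t - 1, q] = ∑ i ∈ Finset.Ico t (K + 1), bpmf[K, i, q] := by linarith
    rw [htail, Finset.mul_sum]
    calc ∑ i ∈ Finset.Ico t (K + 1), (t : ℝ) * bpmf[K, i, q]
        ≤ ∑ i ∈ Finset.Ico t (K + 1), (i : ℝ) * bpmf[K, i, q] := by
          apply Finset.sum_le_sum
          intro i hi
          rw [Finset.mem_Ico] at hi
          exact mul_le_mul_of_nonneg_right (by exact_mod_cast hi.1) (bpmf_nonneg K i hq0 hq1)
      _ ≤ ∑ i ∈ Finset.range (K + 1), (i : ℝ) * bpmf[K, i, q] := by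
          rw [Finset.range_eq_Ico]
          apply Finset.sum_le_sum_of_subset_of_nonneg (Finset.Ico_subset_Ico (by omega) le_rfl)
          intro i _ _
          exact mul_nonneg (Nat.cast_nonneg i) (bpmf_nonneg K i hq0 hq1)

/-! ### Expectations against binomial weights: Pascal split, thinning -/

/-- Pascal split of a `Bin(m+1, λ)` expectation on the last trial. -/
theorem binom_exp_succ (m : ℕ) (l : ℝ) (f : ℕ → ℝ) :
    ∑ K ∈ Finset.range (m + 2), bpmf[m + 1, K, l] * f K =
      l * ∑ K ∈ Finset.range (m + 1), bpmf[m, K, l] * f (K + 1) +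
        (1 - l) * ∑ K ∈ Finset.range (m + 1), bpmf[m, K, l] * f K := by
  rw [Finset.sum_range_succ', bpmf_succ_zero]
  have : ∀ K ∈ Finset.range (m + 1), bpmf[m + 1, K + 1, l] * f (K + 1) =
      l * (bpmf[m, K, l] * f (K + 1)) + (1 - l) * (bpmf[m, K + 1, l] * f (K + 1)) := by
    intro K _; rw [bpmf_succ_succ]; ring
  rw [Finset.sum_congr rfl this, Finset.sum_add_distrib, ← Finset.mul_sum, ← Finset.mul_sum]
  -- (1-l) * [∑_{K<m+1} pmf(m,K+1) f(K+1) + pmf(m,0) f 0] = (1-l) * ∑_{K<m+1} pmf(m,K) f K  (shift; the K = m+1 term vanishes)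
  have hshift : ∑ K ∈ Finset.range (m + 1), bpmf[m, K + 1, l] * f (K + 1) + bpmf[m, 0, l] * f 0 =
      ∑ K ∈ Finset.range (m + 1), bpmf[m, K, l] * f K := by
    have h := (Finset.sum_range_succ' (fun K => bpmf[m, K, l] * f K) (m + 1)).symm
    -- h : ∑_{K<m+1} pmf(m,K+1) f(K+1) + pmf(m,0) f 0 = ∑_{K<m+2} pmf(m,K) f K
    rw [h, Finset.sum_range_succ]
    simp [Nat.choose_succ_self]
  calc l * ∑ K ∈ Finset.range (m + 1), bpmf[m, K, l] * f (K + 1) +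
        (1 - l) * ∑ K ∈ Finset.range (m + 1), bpmf[m, K + 1, l] * f (K + 1) + (1 - l) * bpmf[m, 0, l] * f 0
      = l * ∑ K ∈ Finset.range (m + 1), bpmf[m, K, l] * f (K + 1) +
        (1 - l) * (∑ K ∈ Finset.range (m + 1), bpmf[m, K + 1, l] * f (K + 1) + bpmf[m, 0, l] * f 0) := by ring
    _ = _ := by rw [hshift]

/-- Thinning of the pmf: a `Bin(m, l·q)` count is a `Bin(K, q)` count with `K ~ Bin(m, l)`. -/
theorem bpmf_thin (m n : ℕ) (l q : ℝ) :
    bpmf[m, n, l * q] = ∑ K ∈ Finset.range (m + 1), bpmf[m, K, l] * bpmf[K, n, q] := by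
  induction m generalizing n with
  | zero =>
    rcases n with _ | n
    · simp
    · simp [Nat.choose_eq_zero_of_lt (Nat.succ_pos n)]
  | succ m ih =>
    rw [binom_exp_succ]
    rcases n with _ | n
    · rw [bpmf_succ_zero, ih 0]
      have : ∀ K ∈ Finset.range (m + 1), bpmf[m, K, l] * bpmf[K + 1, 0, q] = (1 - q) * (bpmf[m, K, l] * bpmf[K, 0, q]) := by
        intro K _; rw [bpmf_succ_zero]; ring
      rw [Finset.sum_congr rfl this, ← Finset.mul_sum]
      ring
    · rw [bpmf_succ_succ, ih (n + 1), ih n]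
      have : ∀ K ∈ Finset.range (m + 1), bpmf[m, K, l] * bpmf[K + 1, n + 1, q] =
          (1 - q) * (bpmf[m, K, l] * bpmf[K, n + 1, q]) + q * (bpmf[m, K, l] * bpmf[K, n, q]) := by
        intro K _; rw [bpmf_succ_succ]; ring
      rw [Finset.sum_congr rfl this, Finset.sum_add_distrib, ← Finset.mul_sum, ← Finset.mul_sum]
      ring

/-- Thinning of the cdf. -/
theorem bcdf_thin (m n : ℕ) (l q : ℝ) :
    bcdf[m, n, l * q] = ∑ K ∈ Finset.range (m + 1), bpmf[m, K, l] * bcdf[K, n, q] := by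
  have : ∀ K ∈ Finset.range (m + 1), bpmf[m, K, l] * bcdf[K, n, q] =
      ∑ i ∈ Finset.range (n + 1), bpmf[m, K, l] * bpmf[K, i, q] := fun K _ => Finset.mul_sum _ _ _
  rw [Finset.sum_congr rfl this, Finset.sum_comm]
  exact Finset.sum_congr rfl fun i _ => bpmf_thin m i l q

/-- total binomial weight is one (pmf form). -/
theorem bpmf_sum (m : ℕ) (l : ℝ) : ∑ K ∈ Finset.range (m + 1), bpmf[m, K, l] = 1 := bcdf_self m l

/-! ### Chord below a concave sequence -/

/-- If the decrements `F K − F (K+1)` are non-decreasing on `K < m`, then `F` lies above its chord: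
`m · F K ≥ (m − K) · F 0 + K · F m` for `K ≤ m`. -/
theorem chord_of_concave (F : ℕ → ℝ) (m : ℕ)
    (hconc : ∀ K, K + 1 < m → F K - F (K + 1) ≤ F (K + 1) - F (K + 2)) (K : ℕ) (hK : K ≤ m) :
    ((m : ℝ) - K) * F 0 + K * F m ≤ m * F K := by
  -- d i := F i - F (i+1) is non-decreasing on i < m
  have hmono : ∀ i i', i ≤ i' → i' < m → F i - F (i + 1) ≤ F i' - F (i' + 1) := by
    intro i i' hii' hi'
    induction i' with
    | zero =>
      have : i = 0 := by omega
      subst this; exact le_rfl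
    | succ i' ih =>
      rcases Nat.eq_or_lt_of_le hii' with h | h
      · rw [h]
      · exact (ih (by omega) (by omega)).trans (hconc i' hi')
  -- telescoping: F 0 - F K = ∑_{i<K} d i ≤ K · d(K-1)...; F K - F m = ∑_{K ≤ i < m} d i ≥ (m-K) d K
  have htel : ∀ a b, a ≤ b → F a - F b = ∑ i ∈ Finset.Ico a b, (F i - F (i + 1)) := by
    intro a b hab
    induction b, hab using Nat.le_induction with
    | base => simp
    | succ b hb ih => rw [Finset.sum_Ico_succ_top hb, ← ih]; ring
  rcases Nat.eq_zero_or_pos K with hK0 | hKpos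
  · subst hK0; simp
  rcases Nat.eq_or_lt_of_le hK with hKm | hKm
  · subst hKm; simp
  -- lower part: F 0 - F K ≤ K * (F (K-1) - F K) ≤ K * (F K - F (K+1))   [since K-1 < K < m]
  have hlow : F 0 - F K ≤ (K : ℝ) * (F K - F (K + 1)) := by
    rw [htel 0 K (by omega)]
    calc ∑ i ∈ Finset.Ico 0 K, (F i - F (i + 1)) ≤ ∑ i ∈ Finset.Ico 0 K, (F K - F (K + 1)) :=
          Finset.sum_le_sum fun i hi => by
            rw [Finset.mem_Ico] at hi
            exact hmono i K (by omega) hKm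
      _ = (K : ℝ) * (F K - F (K + 1)) := by simp [mul_sub]
  -- upper part: F K - F m ≥ (m - K) * (F K - F (K+1))
  have hup : ((m : ℝ) - K) * (F K - F (K + 1)) ≤ F K - F m := by
    rw [htel K m hK]
    calc ((m : ℝ) - K) * (F K - F (K + 1)) = ∑ i ∈ Finset.Ico K m, (F K - F (K + 1)) := by
          simp [Nat.cast_sub hK, mul_sub]
      _ ≤ ∑ i ∈ Finset.Ico K m, (F i - F (i + 1)) :=
          Finset.sum_le_sum fun i hi => by
            rw [Finset.mem_Ico] at hi
            exact hmono K i hi.1 hi.2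
  -- combine: m F K - (m-K) F 0 - K F m = (m-K)(F K - F 0) + K (F K - F m) ≥ -(m-K) K d + K (m-K) d = 0
  have hmK : (0 : ℝ) ≤ (m : ℝ) - K := by
    have : (K : ℝ) ≤ m := by exact_mod_cast hK
    linarith
  have hK0 : (0 : ℝ) ≤ K := Nat.cast_nonneg K
  nlinarith [mul_le_mul_of_nonneg_left hlow hmK, mul_le_mul_of_nonneg_left hup hK0]

/-! ### The N12 bridge: `g ≤ P_g` from `Quant.IndepBlob.far_indepBlob` on `Fin m` -/

/-- constant-gate product weight on `Fin m`. -/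
theorem prod_ite_const (m : ℕ) (g : ℝ) (W : Finset (Fin m)) :
    (∏ k : Fin m, (if k ∈ W then g else 1 - g)) = g ^ #W * (1 - g) ^ (m - #W) := by
  rw [Finset.prod_ite, Finset.prod_const, Finset.prod_const]
  have h1 : (Finset.univ.filter fun k : Fin m => k ∈ W) = W := by ext k; simp
  have h2 : (Finset.univ.filter fun k : Fin m => ¬ k ∈ W) = Wᶜ := by ext k; simp
  rw [h1, h2, Finset.card_compl, Fintype.card_fin]

/-- `∑_{W ⊆ Fin m, #W + (n+1) ≤ m} g^{#W} (1−g)^{m−#W} = 1 − P(Bin(m, 1−g) ≤ n)`: at most `m−n−1` open units means at least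
`n+1` closed ones. -/
theorem sum_weight_card_le (m n : ℕ) (hn : n + 1 ≤ m) (g : ℝ) :
    ∑ W : Finset (Fin m), (if #W + (n + 1) ≤ m then g ^ #W * (1 - g) ^ (m - #W) else 0) = 1 - bcdf[m, n, 1 - g] := by
  -- substitute W ↦ Wᶜ
  have hinv : ∑ W : Finset (Fin m), (if #W + (n + 1) ≤ m then g ^ #W * (1 - g) ^ (m - #W) else 0) =
      ∑ V : Finset (Fin m), (if n + 1 ≤ #V then (1 - g) ^ #V * g ^ (m - #V) else 0) := by
    rw [← Equiv.sum_comp (compl_involutive.toPerm (compl : Finset (Fin m) → Finset (Fin m)))]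
    refine Finset.sum_congr rfl fun V _ => ?_
    simp only [Function.Involutive.coe_toPerm]
    have hc : #Vᶜ = m - #V := by rw [Finset.card_compl, Fintype.card_fin]
    have hV : #V ≤ m := by simpa using Finset.card_le_univ V
    rw [hc]
    have e : m - (m - #V) = #V := by omega
    rw [e]
    by_cases h : n + 1 ≤ #V
    · rw [if_pos (by omega), if_pos h]; ring
    · rw [if_neg (by omega), if_neg h]
  rw [hinv]
  -- the summand depends on #V only
  have hcard := Finset.sum_powerset_apply_card (fun i => if n + 1 ≤ i then (1 - g) ^ i * g ^ (m - i) else 0)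
    (x := (Finset.univ : Finset (Fin m)))
  rw [Finset.powerset_univ, Finset.card_univ, Fintype.card_fin] at hcard
  rw [hcard]
  simp only [nsmul_eq_mul]
  -- ∑_{i<m+1} C(m,i) * (if n+1 ≤ i then ḡ^i g^{m-i} else 0) = 1 - bcdf[m, n, ḡ]
  have hsplit : ∑ i ∈ Finset.range (m + 1), ((m.choose i : ℕ) : ℝ) * (if n + 1 ≤ i then (1 - g) ^ i * g ^ (m - i) else 0) =
      ∑ i ∈ (Finset.range (m + 1)).filter (fun i => n + 1 ≤ i), bpmf[m, i, 1 - g] := by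
    rw [Finset.sum_filter]
    refine Finset.sum_congr rfl fun i _ => ?_
    split_ifs <;> simp [sub_sub_cancel]; ring
  have htot : ∑ i ∈ (Finset.range (m + 1)).filter (fun i => n + 1 ≤ i), bpmf[m, i, 1 - g] +
      ∑ i ∈ (Finset.range (m + 1)).filter (fun i => ¬ n + 1 ≤ i), bpmf[m, i, 1 - g] = 1 := by
    rw [Finset.sum_filter_add_sum_filter_not]; exact bpmf_sum m (1 - g)
  have hlow : (Finset.range (m + 1)).filter (fun i => ¬ n + 1 ≤ i) = Finset.range (n + 1) := by
    ext i; simp only [Finset.mem_filter, Finset.mem_range, not_le]; omega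
  rw [hlow] at htot
  have : ∑ x ∈ Finset.range (m + 1), ((m.choose x) : ℝ) * (if n + 1 ≤ x then (1 - g) ^ x * g ^ (m - x) else 0) =
      ∑ i ∈ Finset.range (m + 1), ((m.choose i : ℕ) : ℝ) * (if n + 1 ≤ i then (1 - g) ^ i * g ^ (m - i) else 0) := rfl
  linarith [hsplit, htot]

end QuantCensus.DiscountRow

end Summit.CriticalPhenomena.PercolationContinuityZ3.Theorems
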